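import Summits.HodgeConjecture.HodgeConjecture.Theorems.F0P2oHeisenbergYCoinvariants       -- ★ p830834 (this seat): `S_Y` = the fibre over `0`, `ker φ₀ = span`, equivariance, surjectivity
import Literature.RepresentationTheory.HeisenbergGroup.ImplementerCocycle                   -- ★ `MpPsi`, `MpPsi.toRep`, `Implements`, Weil's section `ofSymplectic`
import HarnessLib

/-!
# Crux `H413`, programme P2, N3 road (S2)-0 — SCHUR ON THE `Y`-COINVARIANTS: an implementer of a symplectic `g` that is TRIVIAL ON `Y^⊥ ∕ Y`
# (`g w − w ∈ Y` for `w ∈ Y^⊥`) acts on `S_Y ≅ 𝒮(F^{ι₀})` by a NON-ZERO SCALAR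

Cell hodgecm-mathlib (D-0151), FLOOR 0, crux item H413 = stmt-HodgeConjecture-24833, programme P2; N3 road (`F0/P2/B-p18/g28/N3-ROAD.v1.B-p18g28.md`,
K1 lead B-p18 (g28)) §2 step **(S2)** «by ★ `omegaLoc_implements`, `ω(p)` for `p ∈ P_Y` normalises `ρ(Y)`, so `P(ℓ) × U(W)` ACTS on `S_Y`; `N(ℓ)` acts on
`𝕎₁ = Y^⊥ ∕ Y` trivially ⇒ commutes with `ρ(H(𝕎₁))` on `S_Y` ⇒ acts by SCALARS (Schur, (S1) irreducible)» and §3 «`m(α)|_{𝕎₁} = id` ⇒ `m(α)` acts on `S_Y`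
by a SCALAR `c(α)`», isolated as MODEL-LEVEL facts in the `Y`-adapted dot model of ★ `F0P2oHeisenbergYCoinvariants` (`Y = 0 × (F^{ι₁} × 0)`,
`Y^⊥ = {x|ι₁ = 0}`, `S_Y` computed by the fibre-over-`0` map `φ₀ : 𝒮(F^{ι₁ ⊔ ι₀}) → 𝒮(F^{ι₀})`).  Seat A-p12 (g17), F0P2-plan (g8) ROW «N3-S1» sequel
(docking note 18:24Z).  THEOREMS ONLY (no `def`, no instance, no notation, no named fact, no `sorry`); never imports a `Cruxes/…/Lines` module;
kernel lane `--supports stmt-HodgeConjecture-24833 --as helper`.  HC_CM is proved only modulo the 2 remaining named inputs (hLiu418, h413) until rung 0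
closes; nothing printed is asserted here.

* §1 (any pseudo-symplectic `s`, any implementer `M`, `M ρ(h) = ρ(s·h) M`): if `s` maps `Y` into `Y` with no central correction (`hsY`) then `M`
  PRESERVES `ker φ₀` (`fibreZero_eq_zero_of_implements`: the `Y`-coboundaries go to `Y`-coboundaries; ★ `ker_fibreZero_eq_span`), so `M` DESCENDS to
  `S_Y` (`exists_descent_of_implements`: a linear `M₀` on `𝒮(F^{ι₀})` with `M₀ ∘ φ₀ = φ₀ ∘ M`); if moreover `s` is trivial on `Y^⊥ ∕ Y` and on the centre over
  `Y^⊥` (`hsYp`: for `x|ι₁ = 0`, `s·((x,y),t)` has the same `x`, the same `y|ι₀`, the same `t`, and still `x|ι₁ = 0`), the descended operator COMMUTES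
  with the Schrödinger model `ρ₀` of `H(𝕎₁)` (★ `fibreZero_schrodingerSB_of_comp_inl_eq_zero`) and is therefore a SCALAR (★ `commutant_schrodingerSB_pi`):
  **`exists_fibreZero_eq_smul_of_implements`** `∃ c, ∀ f, φ₀ (M f) = c • φ₀ f`, with `c ≠ 0` (`φ₀ ∘ M` is onto the non-zero space `𝒮(F^{ι₀})`).
* §2 Weil's section `s = ofSymplectic g` (`2` invertible): the SINGLE hypothesis **`hg : ∀ w, w.1|ι₁ = 0 → ∃ y₁, g w = w + (0, (y₁, 0))`** («`g` is
  trivial on `Y^⊥ ∕ Y`»; it contains `g Y ⊆ Y`) gives `hsY`, `hsYp` — Weil's quadratic correction `½(⟨gw|gw⟩ − ⟨w|w⟩)` VANISHES on `Y^⊥`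
  (`ofSymplectic_f_eq_zero_of_trivial`) — hence **`exists_fibreZero_eq_smul_of_mem_MpPsi`**: every `(g, M) ∈ S̃p_ψ` with `hg` acts on `S_Y` by a
  non-zero scalar, multiplicatively in `(g, M)` (`fibreZero_toRep_mul_eq_smul`).  In the N3 setting `g = ι_v(n)`, `n ∈ N(ℓ)` (fixes `ℓ ⊗ W` and
  `ℓ^⊥ ⊗ W ∕ ℓ ⊗ W` pointwise) and `g = ι_v(m(α))` restricted as in §3 of the road note; the VALUE of the scalar on the centre `n_t` is (S3)
  (★ p829212 ∕ ★ p829499), on the Levi it is N3 (b).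
[MoeglinVignerasWaldspurger1987, Chap. 2 II.1 (A), Chap. 3 §IV.2, §IV.5; Kudla1986, proof of Thm. 2.8; BernsteinZelevinsky1976, §2.30–2.33.]

## References
* [MoeglinVignerasWaldspurger1987] C. Mœglin, M.-F. Vignéras, J.-L. Waldspurger, *Correspondances de Howe sur un corps p-adique*, LNM 1291 (1987):
  Chap. 2 I.3 (Schur for the Heisenberg representation), II.1 (A); Chap. 3 §IV.2 (mixed model), §IV.5 (filtration de Kudla).
* [Kudla1986] S. Kudla, *On the local theta-correspondence*, Invent. Math. 83 (1986): proof of Thm. 2.8.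
* [Weil1964] A. Weil, Acta Math. 111 (1964): n° 5 (the section `σ ↦ (σ, f_σ)`).
* [BernsteinZelevinsky1976] I. N. Bernstein, A. V. Zelevinsky, Russian Math. Surveys 31 (1976): §2.30–2.33.
-/

set_option autoImplicit false
set_option linter.dupNamespace false -- the mandated namespace repeats the single-problem summit's segment

noncomputable section

open Set
open Literature.NumberTheory.Automorphic Literature.RepresentationTheory Literature.RepresentationTheory.HeisenbergGroup
open Summit.HodgeConjecture.HodgeConjecture.Cruxes.H413.F0P2oHeisenbergYCoinvariants

namespace Summit.HodgeConjecture.HodgeConjecture.Cruxes.H413.F0P2oHeisenbergYCoinvariantsSchur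

variable {F : Type*} [Field F] [ValuativeRel F] [TopologicalSpace F] [IsNonarchimedeanLocalField F]
  {ι₁ ι₀ : Type*} [Fintype ι₁] [Fintype ι₀]
  {ψ : AddChar F Circle} (hl : IsLocallyConstant (⇑ψ : F → Circle))
  (hb : ∀ y : ι₁ ⊕ ι₀ → F, Continuous fun u : ι₁ ⊕ ι₀ → F => dotProductBilin F F u y)
  (hb₀ : ∀ y₀ : ι₀ → F, Continuous fun u₀ : ι₀ → F => dotProductBilin F F u₀ y₀)
  (φ₀ : SchwartzBruhat (ι₁ ⊕ ι₀ → F) →ₗ[ℂ] SchwartzBruhat (ι₀ → F))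
  (hφ₀ : ∀ (f : SchwartzBruhat (ι₁ ⊕ ι₀ → F)) (u₀ : ι₀ → F),
    (φ₀ f : (ι₀ → F) → ℂ) u₀ = (f : (ι₁ ⊕ ι₀ → F) → ℂ) (Sum.elim 0 u₀))

/-! ## §1 Implementers normalising `Y` descend to `S_Y`; if trivial on `Y^⊥ ∕ Y` they act by a scalar -/

section Implementer

variable (s : Heisenberg.PseudoSymplectic (polar (dotProductBilin F F (m := ι₁ ⊕ ι₀))))
  (M : SchwartzBruhat (ι₁ ⊕ ι₀ → F) ≃ₗ[ℂ] SchwartzBruhat (ι₁ ⊕ ι₀ → F))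
  (hM : Implements (schrodingerSB (dotProductBilin F F) ψ hl hb) s M)
  (hsY : ∀ y₁ : ι₁ → F, ∃ y₁' : ι₁ → F,
    s.act (⟨(0, Sum.elim y₁ 0), 0⟩ : Heisenberg (polar (dotProductBilin F F (m := ι₁ ⊕ ι₀)))) = ⟨(0, Sum.elim y₁' 0), 0⟩)
  (hsYp : ∀ h : Heisenberg (polar (dotProductBilin F F (m := ι₁ ⊕ ι₀))), h.v.1 ∘ Sum.inl = 0 →
    (s.act h).v.1 ∘ Sum.inl = 0 ∧ (s.act h).v.1 ∘ Sum.inr = h.v.1 ∘ Sum.inr ∧ (s.act h).v.2 ∘ Sum.inr = h.v.2 ∘ Sum.inr ∧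
      (s.act h).t = h.t)

include hφ₀ hM

include hsY in
/-- **an implementer of an `s` with `s(Y) ⊆ Y` (no central correction on `Y`) PRESERVES `ker φ₀`** — it carries each `Y`-coboundary `ρ(y) φ − φ` to the
`Y`-coboundary `ρ(s·y) (Mφ) − Mφ`, and `ker φ₀` is their span (★ `ker_fibreZero_eq_span`). [cite: MoeglinVignerasWaldspurger1987, Chap. 2 II.1 (A); Chap. 3 §IV.2] -/
theorem fibreZero_eq_zero_of_implements (hψ : ψ.IsContinuousNontrivial) {f : SchwartzBruhat (ι₁ ⊕ ι₀ → F)} (hf : φ₀ f = 0) :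
    φ₀ (M f) = 0 := by
  have hker := ker_fibreZero_eq_span hl hb φ₀ hφ₀ hψ
  have hmem : f ∈ LinearMap.ker φ₀ := LinearMap.mem_ker.2 hf
  rw [hker] at hmem
  rw [← LinearMap.mem_ker, hker]
  refine Submodule.span_induction ?_ ?_ ?_ ?_ hmem
  · rintro _ ⟨⟨y₁, φ⟩, rfl⟩
    obtain ⟨y₁', hy⟩ := hsY y₁
    refine Submodule.subset_span ⟨(y₁', M φ), ?_⟩
    dsimp only
    rw [map_sub, hM]
    change _ = (schrodingerSB (dotProductBilin F F) ψ hl hb) (s.act ⟨(0, Sum.elim y₁ 0), 0⟩) (M φ) - M φ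
    rw [hy]
    rfl
  · rw [map_zero]; exact Submodule.zero_mem _
  · intro a b _ _ ha hb'
    rw [map_add]; exact Submodule.add_mem _ ha hb'
  · intro c a _ ha
    rw [map_smul]; exact Submodule.smul_mem _ c ha

include hsY in
/-- **descent to `S_Y`**: such an `M` induces a linear operator `M₀` on `𝒮(F^{ι₀})` with `M₀ (φ₀ f) = φ₀ (M f)` (`φ₀` is onto, ★ `fibreZero_surjective`).
[cite: BernsteinZelevinsky1976, §2.30–2.33] [cite: MoeglinVignerasWaldspurger1987, Chap. 3 §IV.2] -/
theorem exists_descent_of_implements (hψ : ψ.IsContinuousNontrivial) :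
    ∃ M₀ : SchwartzBruhat (ι₀ → F) →ₗ[ℂ] SchwartzBruhat (ι₀ → F), ∀ f, M₀ (φ₀ f) = φ₀ (M f) := by
  have hsurj := fibreZero_surjective φ₀ hφ₀
  have hk : LinearMap.ker φ₀ ≤ LinearMap.ker (φ₀ ∘ₗ (M : SchwartzBruhat (ι₁ ⊕ ι₀ → F) →ₗ[ℂ] SchwartzBruhat (ι₁ ⊕ ι₀ → F))) :=
    fun f hf => LinearMap.mem_ker.2 (fibreZero_eq_zero_of_implements hl hb φ₀ hφ₀ s M hM hsY hψ (LinearMap.mem_ker.1 hf))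
  refine ⟨((LinearMap.ker φ₀).liftQ (φ₀ ∘ₗ (M : SchwartzBruhat (ι₁ ⊕ ι₀ → F) →ₗ[ℂ] SchwartzBruhat (ι₁ ⊕ ι₀ → F))) hk) ∘ₗ
    (φ₀.quotKerEquivOfSurjective hsurj).symm.toLinearMap, fun f => ?_⟩
  have hsymm : (φ₀.quotKerEquivOfSurjective hsurj).symm (φ₀ f) = Submodule.Quotient.mk f := by
    apply (φ₀.quotKerEquivOfSurjective hsurj).injective
    rw [LinearEquiv.apply_symm_apply]
    rfl
  rw [LinearMap.comp_apply, LinearEquiv.coe_toLinearMap, hsymm, Submodule.liftQ_apply]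
  rfl

include hsYp in
/-- **if `s` is trivial on `Y^⊥ ∕ Y` (and on the centre over `Y^⊥`), `M` commutes with `H(Y^⊥)` THROUGH `φ₀`**: for `h` with `x|ι₁ = 0`,
`φ₀ (M (ρ h f)) = ρ₀(h̄) (φ₀ (M f))`, `h̄ = ((x|ι₀, y|ι₀), t)` (★ `fibreZero_schrodingerSB_of_comp_inl_eq_zero` at `s·h`, whose `ι₀`-coordinates and `t`
are those of `h`). [cite: MoeglinVignerasWaldspurger1987, Chap. 3 §IV.2] [cite: Kudla1986, proof of Thm. 2.8] -/
theorem fibreZero_implements_of_trivial (h : Heisenberg (polar (dotProductBilin F F (m := ι₁ ⊕ ι₀)))) (hh : h.v.1 ∘ Sum.inl = 0)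
    (f : SchwartzBruhat (ι₁ ⊕ ι₀ → F)) :
    φ₀ (M (schrodingerSB (dotProductBilin F F) ψ hl hb h f)) =
      schrodingerSB (dotProductBilin F F) ψ hl hb₀ ⟨(h.v.1 ∘ Sum.inr, h.v.2 ∘ Sum.inr), h.t⟩ (φ₀ (M f)) := by
  obtain ⟨h1, h2, h3, h4⟩ := hsYp h hh
  rw [hM, fibreZero_schrodingerSB_of_comp_inl_eq_zero hl hb hb₀ φ₀ hφ₀ (s.act h) h1, h2, h3, h4]

include hb₀ hsY hsYp in
/-- **SCHUR ON `S_Y`**: an implementer `M` of an `s` that maps `Y` into `Y` (no correction) and is trivial on `Y^⊥ ∕ Y` and on the centre over `Y^⊥` acts on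
`S_Y ≅ 𝒮(F^{ι₀})` by a SCALAR: `∃ c, ∀ f, φ₀ (M f) = c • φ₀ f`.  The descended `M₀` (`exists_descent_of_implements`) commutes with every `ρ₀(h₀)`,
`h₀ ∈ H(𝕎₁)` (lift `h₀ = ((x₀,y₀),t)` to `((0 ⊔ x₀, 0 ⊔ y₀), t) ∈ H(Y^⊥)`, ★ `fibreZero_schrodingerSB_sumElim`), so ★ `commutant_schrodingerSB_pi` applies.
[cite: MoeglinVignerasWaldspurger1987, Chap. 2 I.3; Chap. 3 §IV.2] [cite: Kudla1986, proof of Thm. 2.8] -/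
theorem exists_fibreZero_eq_smul_of_implements (hψ : ψ.IsContinuousNontrivial) :
    ∃ c : ℂ, ∀ f : SchwartzBruhat (ι₁ ⊕ ι₀ → F), φ₀ (M f) = c • φ₀ f := by
  obtain ⟨M₀, hM₀⟩ := exists_descent_of_implements hl hb φ₀ hφ₀ s M hM hsY hψ
  have hcomm : ∀ (h₀ : Heisenberg (polar (dotProductBilin F F (m := ι₀)))) (g : SchwartzBruhat (ι₀ → F)),
      M₀ (schrodingerSB (dotProductBilin F F) ψ hl hb₀ h₀ g) = schrodingerSB (dotProductBilin F F) ψ hl hb₀ h₀ (M₀ g) := by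
    rintro ⟨⟨x₀, y₀⟩, t⟩ g
    obtain ⟨f, rfl⟩ := fibreZero_surjective φ₀ hφ₀ g
    rw [← fibreZero_schrodingerSB_sumElim hl hb hb₀ φ₀ hφ₀ x₀ 0 y₀ t f, hM₀, hM₀,
      fibreZero_implements_of_trivial hl hb hb₀ φ₀ hφ₀ s M hM hsYp _ rfl f]
    rfl
  obtain ⟨c, hc⟩ := commutant_schrodingerSB_pi hl hb₀ hψ M₀ hcomm
  exact ⟨c, fun f => by rw [← hM₀, hc]⟩

include hb₀ hsY hsYp in
/-- … and the scalar is NON-ZERO (`φ₀ ∘ M` is onto `𝒮(F^{ι₀}) ∋ 1_{𝒪^{ι₀}} ≠ 0`). [cite: MoeglinVignerasWaldspurger1987, Chap. 2 I.3; Chap. 3 §IV.2] -/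
theorem exists_fibreZero_eq_smul_ne_zero_of_implements (hψ : ψ.IsContinuousNontrivial) :
    ∃ c : ℂ, c ≠ 0 ∧ ∀ f : SchwartzBruhat (ι₁ ⊕ ι₀ → F), φ₀ (M f) = c • φ₀ f := by
  obtain ⟨c, hc⟩ := exists_fibreZero_eq_smul_of_implements hl hb hb₀ φ₀ hφ₀ s M hM hsY hsYp hψ
  refine ⟨c, fun h0 => piBallSB_zero_ne_zero (F := F) (ι := ι₀) ?_, hc⟩
  obtain ⟨f, hf⟩ := fibreZero_surjective φ₀ hφ₀ (piBallSB F ι₀ 0)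
  obtain ⟨f', rfl⟩ := M.surjective f
  rw [← hf, hc, h0, zero_smul]

end Implementer

/-! ## §2 Weil's section: `g` trivial on `Y^⊥ ∕ Y` -/

section OfSymplectic

variable [Invertible (2 : F)] (g : symplecticGroup (polar (dotProductBilin F F (m := ι₁ ⊕ ι₀))))
  (hg : ∀ w : (ι₁ ⊕ ι₀ → F) × (ι₁ ⊕ ι₀ → F), w.1 ∘ Sum.inl = 0 → ∃ y₁ : ι₁ → F, g.1 w = w + (0, Sum.elim y₁ 0))

omit [ValuativeRel F] [TopologicalSpace F] [IsNonarchimedeanLocalField F] in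
include hg in
/-- **Weil's quadratic correction vanishes on `Y^⊥`** for `g` trivial on `Y^⊥ ∕ Y`: `½(⟨gw|gw⟩ − ⟨w|w⟩) = 0` when `w.1|ι₁ = 0` (`g w = w + (0,(y₁,0))`,
`⟨w.1, (y₁, 0)⟩ = ⟨w.1|ι₁, y₁⟩ = 0`). [cite: Weil1964, n° 5] -/
theorem ofSymplectic_f_eq_zero_of_trivial (w : (ι₁ ⊕ ι₀ → F) × (ι₁ ⊕ ι₀ → F)) (hw : w.1 ∘ Sum.inl = 0) :
    (ofSymplectic (polar (dotProductBilin F F (m := ι₁ ⊕ ι₀))) g).f w = 0 := by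
  obtain ⟨y₁, hy⟩ := hg w hw
  rw [ofSymplectic_f, hy, polar_apply, polar_apply, dotProductBilin_apply_apply, dotProductBilin_apply_apply, Prod.fst_add,
    Prod.snd_add]
  change ⅟(2 : F) * ((w.1 + 0) ⬝ᵥ (w.2 + Sum.elim y₁ 0) - w.1 ⬝ᵥ w.2) = 0
  rw [add_zero, dotProduct_add, dotProduct_sumElim_zero, hw, zero_dotProduct, add_zero, sub_self, mul_zero]

omit [ValuativeRel F] [TopologicalSpace F] [IsNonarchimedeanLocalField F] in
include hg in
/-- the action of `ofSymplectic g` on `H(Y^⊥)`: `g · ((x,y),t) = ((x, y + (y₁, 0)), t)`. [cite: Weil1964, n° 5] -/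
theorem exists_act_ofSymplectic_eq (h : Heisenberg (polar (dotProductBilin F F (m := ι₁ ⊕ ι₀)))) (hh : h.v.1 ∘ Sum.inl = 0) :
    ∃ y₁ : ι₁ → F, (ofSymplectic (polar (dotProductBilin F F (m := ι₁ ⊕ ι₀))) g).act h = ⟨(h.v.1, h.v.2 + Sum.elim y₁ 0), h.t⟩ := by
  obtain ⟨⟨x, y⟩, t⟩ := h
  obtain ⟨y₁, hy⟩ := hg (x, y) hh
  have hf := ofSymplectic_f_eq_zero_of_trivial g hg (x, y) hh
  refine ⟨y₁, ?_⟩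
  change (⟨g.1 (x, y), t + (ofSymplectic (polar (dotProductBilin F F (m := ι₁ ⊕ ι₀))) g).f (x, y)⟩ :
      Heisenberg (polar (dotProductBilin F F (m := ι₁ ⊕ ι₀)))) = ⟨(x, y + Sum.elim y₁ 0), t⟩
  rw [hf, add_zero, hy, Prod.mk_add_mk, add_zero]

omit [ValuativeRel F] [TopologicalSpace F] [IsNonarchimedeanLocalField F] [Fintype ι₁] [Fintype ι₀] [Invertible (2 : F)] in
/-- `(y + (y₁, 0))|ι₀ = y|ι₀`. [folklore] -/
theorem add_sumElim_zero_comp_inr (y : ι₁ ⊕ ι₀ → F) (y₁ : ι₁ → F) : (y + Sum.elim y₁ 0) ∘ Sum.inr = y ∘ Sum.inr := by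
  funext j
  change y (Sum.inr j) + Sum.elim y₁ (0 : ι₀ → F) (Sum.inr j) = y (Sum.inr j)
  rw [Sum.elim_inr, Pi.zero_apply, add_zero]

variable (M : SchwartzBruhat (ι₁ ⊕ ι₀ → F) ≃ₗ[ℂ] SchwartzBruhat (ι₁ ⊕ ι₀ → F))
  (hM : Implements (schrodingerSB (dotProductBilin F F) ψ hl hb) (ofSymplectic _ g) M)

include hφ₀ hb₀ hg hM in
/-- **SCHUR ON `S_Y` FOR `g` TRIVIAL ON `Y^⊥ ∕ Y`**: if `g w − w ∈ Y` for every `w ∈ Y^⊥` (one hypothesis `hg`; it contains `g Y ⊆ Y`), EVERY implementer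
`M` of `ofSymplectic g` acts on the `Y`-coinvariants by a non-zero scalar: `∃ c ≠ 0, ∀ f, φ₀ (M f) = c • φ₀ f`.  In the N3 road: `g = ι_v(n)`,
`n ∈ N(ℓ)` (trivial on `ℓ` and on `ℓ^⊥ ∕ ℓ`), and `g =` the part of `ι_v(m(α))` read modulo `Y` — B-p18's «`N(ℓ)` and `m(α)` act on `S_Y` by scalars».
[cite: MoeglinVignerasWaldspurger1987, Chap. 2 I.3, II.1 (A); Chap. 3 §IV.2] [cite: Kudla1986, proof of Thm. 2.8] [cite: Weil1964, n° 5] -/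
theorem exists_fibreZero_eq_smul_of_trivial (hψ : ψ.IsContinuousNontrivial) :
    ∃ c : ℂ, c ≠ 0 ∧ ∀ f : SchwartzBruhat (ι₁ ⊕ ι₀ → F), φ₀ (M f) = c • φ₀ f := by
  refine exists_fibreZero_eq_smul_ne_zero_of_implements hl hb hb₀ φ₀ hφ₀ (ofSymplectic _ g) M hM ?_ ?_ hψ
  · intro y₁
    obtain ⟨y₁', hy⟩ := exists_act_ofSymplectic_eq g hg ⟨(0, Sum.elim y₁ 0), 0⟩ rfl
    refine ⟨y₁ + y₁', ?_⟩
    rw [hy]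
    change (⟨(0, Sum.elim y₁ 0 + Sum.elim y₁' 0), 0⟩ : Heisenberg (polar (dotProductBilin F F (m := ι₁ ⊕ ι₀)))) = _
    rw [sumElim_add_sumElim, add_zero]
  · intro h hh
    obtain ⟨y₁', hy⟩ := exists_act_ofSymplectic_eq g hg h hh
    rw [hy]
    exact ⟨hh, rfl, add_sumElim_zero_comp_inr h.v.2 y₁', rfl⟩

include hφ₀ hb₀ in
/-- **`MpPsi` currency**: a pair `p = (g, M) ∈ S̃p_ψ(𝕎)` with `g` trivial on `Y^⊥ ∕ Y` acts on `S_Y` by a non-zero scalar through the Weil representation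
★ `MpPsi.toRep`. [cite: MoeglinVignerasWaldspurger1987, Chap. 2 II.1 (A); Chap. 3 §IV.2] [cite: Kudla1986, proof of Thm. 2.8] -/
theorem exists_fibreZero_toRep_eq_smul (hψ : ψ.IsContinuousNontrivial) (p : MpPsi (schrodingerSB (dotProductBilin F F (m := ι₁ ⊕ ι₀)) ψ hl hb))
    (hp : ∀ w : (ι₁ ⊕ ι₀ → F) × (ι₁ ⊕ ι₀ → F), w.1 ∘ Sum.inl = 0 →
      ∃ y₁ : ι₁ → F, (p.1.1).1 w = w + (0, Sum.elim y₁ 0)) :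
    ∃ c : ℂ, c ≠ 0 ∧ ∀ f : SchwartzBruhat (ι₁ ⊕ ι₀ → F),
      φ₀ (MpPsi.toRep (schrodingerSB (dotProductBilin F F) ψ hl hb) p f) = c • φ₀ f :=
  exists_fibreZero_eq_smul_of_trivial hl hb hb₀ φ₀ hφ₀ _ hp _ ((mem_MpPsi _ _).1 p.2) hψ

/-- **multiplicativity of the scalars**: if `p` and `q` act on `S_Y` by `c_p` and `c_q` then `p q` acts by `c_p c_q` — the scalars form a CHARACTER of the
subgroup of `S̃p_ψ` trivial on `Y^⊥ ∕ Y` (e.g. of `ι_v(N(ℓ))`). [cite: MoeglinVignerasWaldspurger1987, Chap. 3 §IV.2] -/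
theorem fibreZero_toRep_mul_eq_smul (p q : MpPsi (schrodingerSB (dotProductBilin F F (m := ι₁ ⊕ ι₀)) ψ hl hb)) {cp cq : ℂ}
    (hcp : ∀ f : SchwartzBruhat (ι₁ ⊕ ι₀ → F), φ₀ (MpPsi.toRep (schrodingerSB (dotProductBilin F F) ψ hl hb) p f) = cp • φ₀ f)
    (hcq : ∀ f : SchwartzBruhat (ι₁ ⊕ ι₀ → F), φ₀ (MpPsi.toRep (schrodingerSB (dotProductBilin F F) ψ hl hb) q f) = cq • φ₀ f)
    (f : SchwartzBruhat (ι₁ ⊕ ι₀ → F)) :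
    φ₀ (MpPsi.toRep (schrodingerSB (dotProductBilin F F) ψ hl hb) (p * q) f) = (cp * cq) • φ₀ f := by
  rw [map_mul, Module.End.mul_apply, hcp, hcq, smul_smul]

end OfSymplectic

end Summit.HodgeConjecture.HodgeConjecture.Cruxes.H413.F0P2oHeisenbergYCoinvariantsSchur

end
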